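import Summits.HodgeConjecture.HodgeConjecture.Theses.PeriodDeficiency
import Summits.HodgeConjecture.HodgeConjecture.Theorems.PeriodDeficiencyGenericityReduction
import Literature.AlgebraicGeometry.HodgeTheory.AlgebraicityLocus
import Literature.AlgebraicGeometry.HodgeTheory.HodgeLocus
import Literature.AlgebraicGeometry.HodgeTheory.HodgeConjectureQbarVoisin
import Literature.AlgebraicGeometry.HodgeTheory.HodgeGenericQbarDescent
import Literature.AlgebraicGeometry.HodgeTheory.HodgeStructureOfHodgeModel
import Literature.AlgebraicGeometry.HodgeTheory.ComplexConjugationHolds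
import Literature.AlgebraicGeometry.HodgeTheory.RationalLattice
import Literature.AlgebraicGeometry.Motives.AtypicalHodgeLocus
import Literature.AlgebraicGeometry.Motives.HodgeTensorFactsHolds
import Literature.AlgebraicGeometry.Motives.FamiliesVHS
import Literature.AlgebraicGeometry.Motives.BaseChange
import HarnessLib

/-!
# Route `PeriodDeficiency`, support item `ClassicalGeometricVHS`: the route closes over real carriers

`ClassicalGeometricVHS` (item stmt-HodgeConjecture-11597) posits `∃ B : BettiHodgeData ℂ, B.IsClassical ∧
HodgeTensorFacts ∧ ∀` smooth projective `ℚ̄`-families, `∃ D : GeometricVHSData B (f₀ ⊗_σ ℂ) n i` —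
i.e. a Betti WEIL cohomology theory on complex points (trace, cycle classes, Poincaré duality, Künneth,
Kleiman's (C)-shadows), Betti cycle-class data (orientations, integral cycle classes), and Gauss–Manin
VHS data with flat polarisations.  True on paper (Voisin I Thm. 6.19, §7.1, §11.3; Voisin II §3.1;
Deligne, Hodge II 4.1.1), formally XL, and not constructible before the open named fact
`HodgeTheory.hodgePQ_independent_of_hodgeModel` (`Theorems.hodgePQ_independent_of_classicalGeometricVHS`
in `PeriodDeficiencyClassicalGeometricVHS`).

This helper file records, sorry-free, that the route does NOT need that construction.  The cruxes
`QbarGenericIsHodgeGeneric` / `DeficiencyBound` and the named fact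
`bku_finite_monodromyOrbit_of_isHodgeGenericIn` read the data `(B, D)` only through the fibrewise Hodge
structures `D.hodge t` — pinned (`GeometricVHSData.hodge_F_eq`, `BettiHodgeData.IsClassical` (i')) to
the Hodge filtration of any Hodge model of the fibre `𝒳_t` — and through `HodgeStructure.mtRank` /
`mtDomainDim` of those structures; `GenericityReduction` uses `(B, D)` only to instantiate them
(`Theorems.genericityReduction_of_facts`).  Those fibrewise Hodge structures already exist on the
tree's REAL carriers, unconditionally: `exists_isReal_hodgeModel_holds` (every smooth projective
`X/ℂ` has a real, hence Hodge-symmetric, Hodge model — Serre GAGA §2, de Rham, the Hodge decomposition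
`Motives.isInternal_hodgePQ_holds`), `HodgeModel.hodgeStructure` (THE `ℚ`-Hodge structure of weight
`k` on `Hᵏ(X(ℂ); ℚ)` read through such a model, Voisin I §7.1.1), and
`finite_singularCohomology_rat_complexPoints` (`Hᵏ(X(ℂ); ℚ)` is finite dimensional).

* `realCarrier_support` — the three inputs a real-carrier form of the route needs in place of
  `ClassicalGeometricVHS` are THEOREMS: Hodge-symmetric Hodge models exist, `Hⁱ(X(ℂ); ℚ)` is finite
  dimensional, Deligne's tensor-filtration facts hold (`Motives.hodgeTensorFacts_holds`).
* `hodgeConjecture_of_realCarrier_genericity` — from Lang's descent of `ℚ̄`-closed sets, spreading out,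
  and Voisin's 2007 finite-monodromy mechanism (the three printed named facts of
  `HodgeTheory/HodgeGenericQbarDescent` already used by `Theorems.genericityReduction_of_facts`),
  together with the REAL-CARRIER forms — written out as hypotheses `hBr`, `hG`, no new definition —
  of the BKU fact "Hodge-generic ⇒ finite monodromy orbit of Hodge classes" and of crux 4 "a
  `ℚ̄`-generic point is Hodge-generic", plus `HodgeConjectureQbar` and `HodgeModelsExist`:
  `_root_.HodgeConjecture`.  No `BettiHodgeData`, no `GeometricVHSData`, no `ClassicalGeometricVHS`.
  (The Hodge structures of the fibres are those of CHOSEN Hodge-symmetric models; the hypotheses are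
  quantified over all such choices, which agree on paper — uniqueness of the analytification and
  rigidity of natural de Rham comparisons, cf. `hodgePQ_independent_of_hodgeModel`.)

The file is evidence for the seat's verdict on the item (over-stated for the route: restate cruxes 2
and 4 and the BKU fact over `HodgeModel.hodgeStructure` of Hodge-symmetric models of the fibres
`fiberOver (f₀ ⊗_σ ℂ) t`, and drop the item); nothing here changes any route statement.

## References

* C. Voisin, *Hodge loci and absolute Hodge classes*, Compositio Math. 143 (2007), Prop. 0.7 / §3.
* F. Charles, C. Schnell, *Notes on absolute Hodge classes* (2014), §11.3.5, Thm. 11.3.19.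
* G. Baldi, B. Klingler, E. Ullmo, *On the distribution of the Hodge locus*, Invent. Math. 235
  (2024), §3.2.
* S. Lang, *Introduction to Algebraic Geometry* (1958), Ch. III §5.
* C. Voisin, *Hodge Theory and Complex Algebraic Geometry I* (2002), §6.1.3, §7.1.1.
-/

noncomputable section

open CategoryTheory AlgebraicGeometry Topology
open Literature.AlgebraicGeometry.Motives Literature.AlgebraicGeometry.HodgeTheory
open Literature.AlgebraicTopology.SingularHomology

-- `Summit.HodgeConjecture.HodgeConjecture.Theorems` is the mandated namespace (single-problem summit:
-- Problem = Summit), which `linter.dupNamespace` flags; the lakefile turns the linter off tree-wide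
-- (weak option), restated here so stand-alone elaboration is warning-free too.
set_option linter.dupNamespace false

namespace Summit.HodgeConjecture.HodgeConjecture.Theorems

/-- **The real-carrier replacement of `ClassicalGeometricVHS` is a theorem.**  (1) Every smooth
projective complex variety has a Hodge-symmetric Hodge model (`exists_isReal_hodgeModel_holds`,
`HodgeModel.IsReal.isHodgeSymmetric`: Serre GAGA §2, de Rham, Voisin I Prop. 6.11 / Cor. 6.12);
(2) `Hⁱ(X(ℂ); ℚ)` is finite dimensional (`finite_singularCohomology_rat_complexPoints`, Hatcher
Cor. A.9); (3) Deligne's tensor-filtration facts hold (`Motives.hodgeTensorFacts_holds`, Hodge II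
1.1.6–1.1.12).  These are exactly the inputs under which `HodgeModel.hodgeStructure` and
`HodgeStructure.mtRank` make sense on the fibres of a family, i.e. under which the real-carrier forms
of cruxes 2 and 4 of the route can be stated and instantiated.
[cite: VoisinHodgeI2002, §6.1.3 Prop. 6.11 and Cor. 6.12] [cite: DeligneHodgeII1971, 1.1.6–1.1.12] -/
theorem realCarrier_support :
    (∀ (n : ℕ) (X : SchemeOver ℂ), IsSmoothProjective n X →
        ∃ A : HodgeModel n X, A.IsHodgeSymmetric) ∧
    (∀ (n : ℕ) (X : SchemeOver ℂ), IsSmoothProjective n X → ∀ i : ℕ,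
        Module.Finite ℚ (singularCohomology ℚ ℚ (ComplexPoints X) i)) ∧
    HodgeTensorFacts.{0, 0} :=
  ⟨fun _ _ hX ↦ exists_isReal_hodgeModel_holds.exists_isHodgeSymmetric hX,
    fun _ _ hX i ↦ finite_singularCohomology_rat_complexPoints hX i,
    hodgeTensorFacts_holds⟩

/-- **The route closes over real carriers, without `ClassicalGeometricVHS`.**  Hypotheses: Lang's
descent of `ℚ̄`-closed sets of complex points (`lang1958_isDefinedOverQbar_descends`), spreading out of a
smooth projective complex variety to a `ℚ̄`-generic fibre of a smooth projective `ℚ̄`-family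
(`spreadingOut_smoothProjective_qbarFamily`), Voisin's mechanism "finite monodromy orbit + HC over `ℚ̄`
⇒ algebraic" (`voisin2007_algebraic_of_finite_monodromyOrbit_of_qbar`) — the three printed facts used by
`Theorems.genericityReduction_of_facts` — and, ON REAL CARRIERS (Hodge structures
`(A t).hodgeStructure` of Hodge-symmetric Hodge models `A t` of the fibres, `HodgeStructure.mtRank`):
`hBr`, the BKU statement "at a point of maximal Mumford–Tate rank on `S(ℂ)` every rational `(p,p)`
class has finite monodromy orbit" (Baldi–Klingler–Ullmo §3.2 with Klingler–Otwinowska–Urbanik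
§1.1.1), and `hG`, crux 4 of the route "the Mumford–Tate rank at `s` is maximal on the `ℚ̄`-Zariski
closure of `s`"; finally the Hodge conjecture over `ℚ̄` and the existence of Hodge models (route decls
`HodgeConjectureQbar`, `HodgeModelsExist`).  Conclusion: `_root_.HodgeConjecture`.  Proof = that of
`genericityReduction_of_facts` with the Betti–Hodge datum `B` and the VHS datum `D` replaced by CHOSEN
Hodge-symmetric Hodge models of the fibres (`exists_isReal_hodgeModel_holds`), finiteness and tensor
facts being theorems (`realCarrier_support`).  Hence the support item `ClassicalGeometricVHS` (a Betti
Weil cohomology theory + Gauss–Manin VHS data) is not needed by the route once cruxes 2, 4 and the BKU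
fact are stated over real carriers.
[cite: Voisin2007HodgeLoci, Prop. 0.7 and §3 (proof of Prop. 1.7)]
[cite: CharlesSchnell2014Notes, §11.3.5 and Thm. 11.3.19]
[cite: BaldiKlinglerUllmo2024, §3.2] -/
theorem hodgeConjecture_of_realCarrier_genericity
    (hL : lang1958_isDefinedOverQbar_descends)
    (hSp : spreadingOut_smoothProjective_qbarFamily)
    (hV : voisin2007_algebraic_of_finite_monodromyOrbit_of_qbar)
    (hBr : ∀ [HodgeTensorFacts.{0, 0}] (σ : AlgebraicClosure ℚ →+* ℂ)
      ⦃𝒳₀ S₀ : SchemeOver (AlgebraicClosure ℚ)⦄ (f₀ : 𝒳₀ ⟶ S₀) (n p : ℕ)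
      (hf : IsSmoothProjectiveFamily ((baseChangeHom σ).map f₀) n),
      IsQuasiProjectiveOver 𝒳₀ → IsQuasiProjectiveOver S₀ → IrreducibleSpace S₀.left →
      AlgebraicGeometry.Smooth S₀.hom →
      ∀ (A : ∀ t : ComplexPoints ((baseChangeHom σ).obj S₀),
          HodgeModel n (fiberOver ((baseChangeHom σ).map f₀) t))
        (hA : ∀ t, (A t).IsHodgeSymmetric)
        [∀ t, Module.Finite ℚ
          (singularCohomology ℚ ℚ (ComplexPoints (fiberOver ((baseChangeHom σ).map f₀) t)) (2 * p))]
        (s : ComplexPoints ((baseChangeHom σ).obj S₀)),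
        (∀ t, ((A t).hodgeStructure (hf.isSmoothProjective t) (hA t) (2 * p)).mtRank ≤
            ((A s).hodgeStructure (hf.isSmoothProjective s) (hA s) (2 * p)).mtRank) →
        ∀ (α : complexBetti (fiberOver ((baseChangeHom σ).map f₀) s) (2 * p)),
          IsRationalClass α →
          IsOfHodgeType n (fiberOver ((baseChangeHom σ).map f₀) s) (2 * p) p p α →
            {β : complexBetti (fiberOver ((baseChangeHom σ).map f₀) s) (2 * p) |
                ∃ γ : Path s s, IsContinuationAlong γ α β}.Finite)
    (hG : ∀ [HodgeTensorFacts.{0, 0}] (σ : AlgebraicClosure ℚ →+* ℂ)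
      ⦃𝒳₀ S₀ : SchemeOver (AlgebraicClosure ℚ)⦄ (f₀ : 𝒳₀ ⟶ S₀) (n i : ℕ)
      (hf : IsSmoothProjectiveFamily ((baseChangeHom σ).map f₀) n),
      IrreducibleSpace S₀.left → AlgebraicGeometry.Smooth S₀.hom →
      ∀ (A : ∀ t : ComplexPoints ((baseChangeHom σ).obj S₀),
          HodgeModel n (fiberOver ((baseChangeHom σ).map f₀) t))
        (hA : ∀ t, (A t).IsHodgeSymmetric)
        [∀ t, Module.Finite ℚ
          (singularCohomology ℚ ℚ (ComplexPoints (fiberOver ((baseChangeHom σ).map f₀) t)) i)]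
        (s : ComplexPoints ((baseChangeHom σ).obj S₀)),
        ∀ t ∈ ⋂₀ {Z | IsDefinedOverQbar σ S₀ Z ∧ s ∈ Z},
          ((A t).hodgeStructure (hf.isSmoothProjective t) (hA t) i).mtRank ≤
            ((A s).hodgeStructure (hf.isSmoothProjective s) (hA s) i).mtRank)
    (hQ : Theses.PeriodDeficiency.HodgeConjectureQbar)
    (hM : Theses.PeriodDeficiency.HodgeModelsExist) :
    _root_.HodgeConjecture := by
  intro n X hX
  obtain ⟨σ⟩ := exists_ringHom_algebraicClosure_rat_complex
  obtain ⟨𝒳₀, S₀, f₀, s, h𝒳₀, hS₀, hirr, hsm, hf, hgen, ⟨e⟩⟩ := hSp σ hX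
  have hXs : IsSmoothProjective n (fiberOver ((baseChangeHom σ).map f₀) s) :=
    hf.isSmoothProjective s
  haveI : HodgeTensorFacts.{0, 0} := hodgeTensorFacts_holds
  -- Hodge-symmetric Hodge models of all fibres (chosen)
  choose A hA using fun t : ComplexPoints ((baseChangeHom σ).obj S₀) ↦
    exists_isReal_hodgeModel_holds.exists_isHodgeSymmetric (hf.isSmoothProjective t)
  -- the cycle part of the Hodge conjecture for the fibre `𝒳_s`
  have hfib : ∀ (p : ℕ) (α : complexBetti (fiberOver ((baseChangeHom σ).map f₀) s) (2 * p)),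
      IsRationalClass α → IsOfHodgeType n (fiberOver ((baseChangeHom σ).map f₀) s) (2 * p) p p α →
        α ∈ algebraicClasses (fiberOver ((baseChangeHom σ).map f₀) s) p := by
    intro p α hαr hαh
    haveI : ∀ t : ComplexPoints ((baseChangeHom σ).obj S₀), Module.Finite ℚ
        (singularCohomology ℚ ℚ (ComplexPoints (fiberOver ((baseChangeHom σ).map f₀) t)) (2 * p)) :=
      fun t ↦ finite_singularCohomology_rat_complexPoints (hf.isSmoothProjective t) (2 * p)
    -- `s` is Hodge-generic in its `ℚ̄`-Zariski closure, which is everything (Lang)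
    have hHG := hG σ f₀ n (2 * p) hf hirr hsm A hA s
    have hW : (⋂₀ {Z | IsDefinedOverQbar σ S₀ Z ∧ s ∈ Z}) =
        (Set.univ : Set (ComplexPoints ((baseChangeHom σ).obj S₀))) := by
      rw [Set.sInter_eq_univ]
      rintro Z ⟨hZ, hsZ⟩
      exact eq_univ_of_isDefinedOverQbar_of_dense hL σ hS₀ hgen hZ hsZ
    rw [hW] at hHG
    -- finite monodromy (BKU on real carriers), then `ℚ̄`-descent of algebraicity (Voisin 2007)
    have hfinOrbit := hBr σ f₀ n p hf h𝒳₀ hS₀ hirr hsm A hA s (fun t ↦ hHG t (Set.mem_univ t))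
      α hαr hαh
    exact hV σ f₀ n p h𝒳₀ hS₀ hirr hsm hf s α hαr hαh hfinOrbit
      (fun m X₀ hX₀ q c hc hh ↦ (hQ σ hX₀).2 q c hc hh)
  -- transport along `e : X ≅ 𝒳_s`
  obtain ⟨A₀⟩ := hM n _ hXs
  refine ⟨⟨A₀.ofIso e⟩, fun p c hc hpp ↦ ?_⟩
  have halg := mem_algebraicClasses_map_of_iso hXs hX e
    (hfib p (singularCohomology.map ℂ ℂ (AlgPoints.mapContinuous (L := ℂ) e.inv) (2 * p) c)
      (hc.map _) (hpp.map_of_iso e.symm))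
  rwa [show complexBetti.map e.hom (2 * p)
      (singularCohomology.map ℂ ℂ (AlgPoints.mapContinuous (L := ℂ) e.inv) (2 * p) c) = c from
    map_hom_map_inv_apply e (2 * p) c] at halg

end Summit.HodgeConjecture.HodgeConjecture.Theorems

end
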